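import Mathlib
import Literature.Analysis.FluidPDE.VectorCalculus

/-!
# Moments of the Rosenhead-regularised Biot–Savart kernel on a symmetric window

Tools stub `stub_rosenheadMoments` of line `Sketch` (crux `SkeletonEquilibrium`, thesis
`FilamentSkeletonRss`). For the Rosenhead kernel `K_e(s) = (s² + e²)^{-3/2}` with core `e > 0` and a
symmetric window `[-δ, δ]`, the zeroth, first and second moments are available in closed form:
* `∫_{-δ}^{δ} K_e = 2δ / (e² √(δ² + e²))` (primitive `s / (e² √(s² + e²))`),
* `∫_{-δ}^{δ} s K_e = 0` (primitive `-1/√(s² + e²)`, an even function),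
* `∫_{-δ}^{δ} s² K_e = 2 (arsinh(δ/e) − δ/√(δ² + e²))` (primitive `arsinh(s/e) − s/√(s² + e²)`),
the last one being the local-induction coefficient of a vortex filament with core `e`.
Everything is Mathlib: the fundamental theorem of calculus for interval integrals
(`intervalIntegral.integral_eq_sub_of_hasDerivAt`, the integrands being continuous since
`s² + e² > 0`), the `Real.sqrt` calculus, `Real.hasDerivAt_arsinh` and `Real.arsinh_neg`.
-/

noncomputable section

open MeasureTheory Filter Topology
open Literature.Analysis.FluidPDE

namespace Summit.NavierStokesRegularity.NavierStokesRegularity.Theorems.SkeletonEquilibrium.Sketch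
set_option linter.dupNamespace false

/-- `b ^ (3/2) = b √b` for `0 < b`. [folklore] -/
private theorem rm_rpow_three_halves {b : ℝ} (hb : 0 < b) :
    b ^ (3 / 2 : ℝ) = b * Real.sqrt b := by
  rw [show (3 / 2 : ℝ) = 1 + 1 / 2 by norm_num, Real.rpow_add hb, Real.rpow_one, Real.sqrt_eq_rpow]

/-- The Rosenhead kernel `s ↦ ((s² + e²)^{3/2})⁻¹` is continuous for `e > 0`. [folklore] -/
private theorem rm_continuous_kernel {e : ℝ} (he : 0 < e) :
    Continuous fun s : ℝ => ((s ^ 2 + e ^ 2) ^ (3 / 2 : ℝ))⁻¹ :=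
  (((continuous_pow 2).add continuous_const).rpow_const fun _ => Or.inr (by norm_num)).inv₀
    fun s => (Real.rpow_pos_of_pos (by positivity : (0 : ℝ) < s ^ 2 + e ^ 2) _).ne'

/-- `(s² + A)' = 2 s`. [folklore] -/
private theorem rm_hasDerivAt_sq_add (A s : ℝ) :
    HasDerivAt (fun s : ℝ => s ^ 2 + A) (2 * s) s := by
  simpa using (hasDerivAt_pow 2 s).add_const A

/-- `(√(s² + A))' = 2 s / (2 √(s² + A))` for `A > 0`. [folklore] -/
private theorem rm_hasDerivAt_sqrt_sq_add {A : ℝ} (hA : 0 < A) (s : ℝ) :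
    HasDerivAt (fun s : ℝ => Real.sqrt (s ^ 2 + A)) (2 * s / (2 * Real.sqrt (s ^ 2 + A))) s :=
  (rm_hasDerivAt_sq_add A s).sqrt (by positivity : (0 : ℝ) < s ^ 2 + A).ne'

/-- Primitive of the zeroth moment: `(s / (A √(s² + A)))' = ((s² + A)^{3/2})⁻¹` for `A > 0`.
[folklore] -/
private theorem rm_hasDerivAt_prim0 {A : ℝ} (hA : 0 < A) (s : ℝ) :
    HasDerivAt (fun s : ℝ => s / (A * Real.sqrt (s ^ 2 + A)))
      (((s ^ 2 + A) ^ (3 / 2 : ℝ))⁻¹) s := by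
  -- adapted from `hasDerivAt_lineKernel_primitive` in
  -- `Theorems/FilamentSkeletonRssSkeletonEquilibriumLineBiotSavart.lean`
  have hb : 0 < s ^ 2 + A := by positivity
  have hr : 0 < Real.sqrt (s ^ 2 + A) := Real.sqrt_pos.2 hb
  have h2 : HasDerivAt (fun s : ℝ => A * Real.sqrt (s ^ 2 + A))
      (A * (2 * s / (2 * Real.sqrt (s ^ 2 + A)))) s :=
    (rm_hasDerivAt_sqrt_sq_add hA s).const_mul A
  refine ((hasDerivAt_id' s).div h2 (mul_pos hA hr).ne').congr_deriv ?_
  rw [rm_rpow_three_halves hb]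
  have hsq : Real.sqrt (s ^ 2 + A) ^ 2 = s ^ 2 + A := Real.sq_sqrt hb.le
  generalize Real.sqrt (s ^ 2 + A) = r at hr hsq ⊢
  rw [← hsq]
  field_simp
  linear_combination hsq

/-- Primitive of the first moment: `(-(√(s² + A))⁻¹)' = s ((s² + A)^{3/2})⁻¹` for `A > 0`.
[folklore] -/
private theorem rm_hasDerivAt_prim1 {A : ℝ} (hA : 0 < A) (s : ℝ) :
    HasDerivAt (fun s : ℝ => -(Real.sqrt (s ^ 2 + A))⁻¹)
      (s * ((s ^ 2 + A) ^ (3 / 2 : ℝ))⁻¹) s := by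
  have hb : 0 < s ^ 2 + A := by positivity
  have hr : 0 < Real.sqrt (s ^ 2 + A) := Real.sqrt_pos.2 hb
  refine (((rm_hasDerivAt_sqrt_sq_add hA s).inv hr.ne').neg).congr_deriv ?_
  rw [rm_rpow_three_halves hb]
  have hsq : Real.sqrt (s ^ 2 + A) ^ 2 = s ^ 2 + A := Real.sq_sqrt hb.le
  have hr' : Real.sqrt (s ^ 2 + A) ≠ 0 := hr.ne'
  generalize Real.sqrt (s ^ 2 + A) = r at hr hsq hr' ⊢
  rw [← hsq]
  field_simp

/-- `√(1 + (s/e)²) = √(s² + e²) / e` for `e > 0`. [folklore] -/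
private theorem rm_sqrt_one_add_div_sq {e : ℝ} (he : 0 < e) (s : ℝ) :
    Real.sqrt (1 + (s / e) ^ 2) = Real.sqrt (s ^ 2 + e ^ 2) / e := by
  have he' : e ≠ 0 := he.ne'
  rw [show 1 + (s / e) ^ 2 = (s ^ 2 + e ^ 2) / e ^ 2 by field_simp; ring,
    Real.sqrt_div' _ (sq_nonneg e), Real.sqrt_sq he.le]

/-- `(arsinh(s/e))' = (√(s² + e²))⁻¹` for `e > 0`. [folklore] -/
private theorem rm_hasDerivAt_arsinh_div {e : ℝ} (he : 0 < e) (s : ℝ) :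
    HasDerivAt (fun s : ℝ => Real.arsinh (s / e)) (Real.sqrt (s ^ 2 + e ^ 2))⁻¹ s := by
  have he' : e ≠ 0 := he.ne'
  have hr' : Real.sqrt (s ^ 2 + e ^ 2) ≠ 0 :=
    (Real.sqrt_pos.2 (by positivity : (0 : ℝ) < s ^ 2 + e ^ 2)).ne'
  have hdiv : HasDerivAt (fun s : ℝ => s / e) (1 / e) s := by
    simpa using (hasDerivAt_id s).div_const e
  have h := (Real.hasDerivAt_arsinh (s / e)).comp s hdiv
  refine (h.congr_deriv ?_ : HasDerivAt (Real.arsinh ∘ fun s : ℝ => s / e) _ s)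
  rw [rm_sqrt_one_add_div_sq he s]
  field_simp

/-- Primitive of the second moment:
`(arsinh(s/e) − s/√(s² + e²))' = s² ((s² + e²)^{3/2})⁻¹` for `e > 0`. [folklore] -/
private theorem rm_hasDerivAt_prim2 {e : ℝ} (he : 0 < e) (s : ℝ) :
    HasDerivAt (fun s : ℝ => Real.arsinh (s / e) - s / Real.sqrt (s ^ 2 + e ^ 2))
      (s ^ 2 * ((s ^ 2 + e ^ 2) ^ (3 / 2 : ℝ))⁻¹) s := by
  have hA : 0 < e ^ 2 := by positivity
  have hb : 0 < s ^ 2 + e ^ 2 := by positivity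
  have hr : 0 < Real.sqrt (s ^ 2 + e ^ 2) := Real.sqrt_pos.2 hb
  have h3 := (hasDerivAt_id' s).div (rm_hasDerivAt_sqrt_sq_add hA s) hr.ne'
  refine ((rm_hasDerivAt_arsinh_div he s).sub h3).congr_deriv ?_
  rw [rm_rpow_three_halves hb]
  have hsq : Real.sqrt (s ^ 2 + e ^ 2) ^ 2 = s ^ 2 + e ^ 2 := Real.sq_sqrt hb.le
  have hr' : Real.sqrt (s ^ 2 + e ^ 2) ≠ 0 := hr.ne'
  generalize Real.sqrt (s ^ 2 + e ^ 2) = r at hr hsq hr' ⊢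
  rw [← hsq]
  field_simp
  ring

/-- Zeroth moment: `∫_{-δ}^{δ} ((s² + e²)^{3/2})⁻¹ ds = 2δ / (e² √(δ² + e²))` (`e > 0`). [folklore] -/
private theorem rm_moment0 {e : ℝ} (he : 0 < e) (δ : ℝ) :
    ∫ s in (-δ)..δ, ((s ^ 2 + e ^ 2) ^ (3 / 2 : ℝ))⁻¹
      = 2 * δ / (e ^ 2 * Real.sqrt (δ ^ 2 + e ^ 2)) := by
  have hA : 0 < e ^ 2 := by positivity
  rw [intervalIntegral.integral_eq_sub_of_hasDerivAt (fun s _ => rm_hasDerivAt_prim0 hA s)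
    ((rm_continuous_kernel he).intervalIntegrable _ _)]
  rw [neg_sq]
  ring

/-- First moment: `∫_{-δ}^{δ} s ((s² + e²)^{3/2})⁻¹ ds = 0` (`e > 0`). [folklore] -/
private theorem rm_moment1 {e : ℝ} (he : 0 < e) (δ : ℝ) :
    ∫ s in (-δ)..δ, s * ((s ^ 2 + e ^ 2) ^ (3 / 2 : ℝ))⁻¹ = 0 := by
  have hA : 0 < e ^ 2 := by positivity
  have hc : Continuous fun s : ℝ => s * ((s ^ 2 + e ^ 2) ^ (3 / 2 : ℝ))⁻¹ :=
    continuous_id.mul (rm_continuous_kernel he)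
  rw [intervalIntegral.integral_eq_sub_of_hasDerivAt (fun s _ => rm_hasDerivAt_prim1 hA s)
    (hc.intervalIntegrable _ _)]
  rw [neg_sq, sub_self]

/-- Second moment (the local-induction coefficient):
`∫_{-δ}^{δ} s² ((s² + e²)^{3/2})⁻¹ ds = 2 (arsinh(δ/e) − δ/√(δ² + e²))` (`e > 0`). [folklore] -/
private theorem rm_moment2 {e : ℝ} (he : 0 < e) (δ : ℝ) :
    ∫ s in (-δ)..δ, s ^ 2 * ((s ^ 2 + e ^ 2) ^ (3 / 2 : ℝ))⁻¹
      = 2 * (Real.arsinh (δ / e) - δ / Real.sqrt (δ ^ 2 + e ^ 2)) := by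
  have hc : Continuous fun s : ℝ => s ^ 2 * ((s ^ 2 + e ^ 2) ^ (3 / 2 : ℝ))⁻¹ :=
    (continuous_pow 2).mul (rm_continuous_kernel he)
  rw [intervalIntegral.integral_eq_sub_of_hasDerivAt (fun s _ => rm_hasDerivAt_prim2 he s)
    (hc.intervalIntegrable _ _)]
  simp only [neg_sq, neg_div, Real.arsinh_neg]
  ring

/-- **Tools stub** (`stub_rosenheadMoments`): the zeroth, first and second moments of the
Rosenhead-regularised Biot–Savart kernel `K_e(s) = ((s² + e²)^{3/2})⁻¹` (core `e > 0`) on the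
symmetric window `[-δ, δ]` (`δ ≥ 0`), in closed form:
`∫ K_e = 2δ / (e² √(δ² + e²))`, `∫ s K_e = 0`, `∫ s² K_e = 2 (arsinh(δ/e) − δ/√(δ² + e²))`.
[folklore] -/
theorem stub_rosenheadMoments :
    (∀ e δ : ℝ, 0 < e → 0 ≤ δ →
      ∫ s in (-δ)..δ, ((s ^ 2 + e ^ 2) ^ (3 / 2 : ℝ))⁻¹ = 2 * δ / (e ^ 2 * Real.sqrt (δ ^ 2 + e ^ 2))) ∧
    (∀ e δ : ℝ, 0 < e → 0 ≤ δ →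
      ∫ s in (-δ)..δ, s * ((s ^ 2 + e ^ 2) ^ (3 / 2 : ℝ))⁻¹ = 0) ∧
    (∀ e δ : ℝ, 0 < e → 0 ≤ δ →
      ∫ s in (-δ)..δ, s ^ 2 * ((s ^ 2 + e ^ 2) ^ (3 / 2 : ℝ))⁻¹
        = 2 * (Real.arsinh (δ / e) - δ / Real.sqrt (δ ^ 2 + e ^ 2))) :=
  ⟨fun _ δ he _ => rm_moment0 he δ, fun _ δ he _ => rm_moment1 he δ,
    fun _ δ he _ => rm_moment2 he δ⟩

end Summit.NavierStokesRegularity.NavierStokesRegularity.Theorems.SkeletonEquilibrium.Sketch
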